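import Literature.RepresentationTheory.HeisenbergGroup.SchrodingerModel
import HarnessLib

/-!
# Frobenius reciprocity into the Schrödinger model: a representation of the Heisenberg group with central character
# `ψ` and a `Y`-invariant functional maps equivariantly to `(schrodinger β ψ, X → ℂ)`

Topic `RepresentationTheory/HeisenbergGroup`; namespace `Literature.RepresentationTheory.HeisenbergGroup`.  KERNEL ONLY:
one definition with body (the intertwiner) and theorems; no record, no named fact, no `sorry`.

Let `β : X →ₗ[R] Y →ₗ[R] R` be a pairing, `ψ : AddChar R Circle`, and `ρ` ANY representation of the polarised
Heisenberg group `Heisenberg (polar β)` (law `((x,y),t)((x',y'),t') = ((x+x',y+y'), t+t'+β x y')`, tree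
`HeisenbergGroup.lean`) on a complex vector space `S`, with CENTRAL CHARACTER `ψ` (`ρ((0,0),t) = ψ(t)·id`), and let
`Λ : S →ₗ[ℂ] ℂ` be a linear functional INVARIANT under the Lagrangian `Y`: `Λ(ρ((0,y),0) f) = Λ(f)`.  Then
(**`frobeniusToSchrodinger`**)

  `T_Λ f := (x ↦ Λ(ρ((x,0),0) f)) : S →ₗ[ℂ] (X → ℂ)`

INTERTWINES `ρ` with the Schrödinger model `schrodinger β ψ` on functions `X → ℂ` (`SchrodingerModel.lean`,
`(ρ_X((x,y),t) g)(u) = ψ(t + β u y) g(u + x)`):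

  **`frobeniusToSchrodinger_apply_rep`**: `T_Λ (ρ h f) = schrodinger β ψ h (T_Λ f)` for every `h`.

This is Frobenius reciprocity for the model «induced from `Y · Z`» ([MoeglinVignerasWaldspurger1987, Chap. 2 I.3:
the model `S_A` of functions `f(ahδ(?)) = ψ_A(a) f(h)`, here `A = Y ⊕ Z`]; [Weil1964, n° 11–12]): a `(Y·Z, ψ)`-quasi-
invariant functional on any `ψ`-representation IS an intertwiner into the Schrödinger model.  It is the algebraic
half of the CHANGE OF POLARISATION between two Schrödinger models of one symplectic space ([MVW87, Chap. 2 I.7]): for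
`ρ = ρ_{X'}` the Schrödinger model of another polarisation `X' ⊕ Y'` (transported along an isomorphism of Heisenberg
groups fixing the centre) and `Λ` its `Y`-invariant functional (a partial integral), `T_Λ` is the partial Fourier
transform intertwining the two models; that it lands in Schwartz–Bruhat functions and is bijective there is analysis,
left to the sequel.

Written for the cell `hodgecm-mathlib` (fan B, rung B-IV, KEY `b4-howe-compact-irreducible`, node E2 of the doubling
proof of `MoeglinVignerasWaldspurger1987.mvw_IV4_rankOne_irreducibleOrZero`: the doubled Weil representation on
`𝒮(Xᴺ) ⊗ 𝒮(Xᴺ)` is moved to the Schrödinger model adapted to the diagonal Lagrangian `ℓ_Δ`, with `Λ = ` the canonical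
pairing `∫ f₁ f₂`).  Nothing about theta lifts is asserted here.

## References
* [MoeglinVignerasWaldspurger1987] C. Mœglin, M.-F. Vignéras, J.-L. Waldspurger, LNM 1291 (1987), Chap. 2 I.3, I.7.
* [Weil1964] A. Weil, Acta Math. 111 (1964), Chap. I n° 11–12.
-/

set_option autoImplicit false

noncomputable section

namespace Literature.RepresentationTheory.HeisenbergGroup

universe u v w

variable {R : Type u} [CommRing R] {X Y : Type v} [AddCommGroup X] [Module R X] [AddCommGroup Y] [Module R Y]
  (β : X →ₗ[R] Y →ₗ[R] R) (ψ : AddChar R Circle)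
  {S : Type w} [AddCommGroup S] [Module ℂ S] (ρ : Representation ℂ (Heisenberg (polar β)) S)

/-- the Heisenberg element `((x, 0), 0)` of the Lagrangian `X`. [cite: MoeglinVignerasWaldspurger1987, Chap. 2 I.4 Exemple (1)] -/
def inX (x : X) : Heisenberg (polar β) := ⟨(x, 0), 0⟩

/-- the Heisenberg element `((0, y), 0)` of the Lagrangian `Y`. [cite: MoeglinVignerasWaldspurger1987, Chap. 2 I.4 Exemple (1)] -/
def inY (y : Y) : Heisenberg (polar β) := ⟨(0, y), 0⟩

/-- components of `inX x`. [cite: MoeglinVignerasWaldspurger1987, Chap. 2 I.4 Exemple (1)] -/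
@[simp] theorem inX_v (x : X) : (inX β x).v = (x, 0) := rfl
/-- components of `inX x`. [cite: MoeglinVignerasWaldspurger1987, Chap. 2 I.4 Exemple (1)] -/
@[simp] theorem inX_t (x : X) : (inX β x).t = 0 := rfl
/-- components of `inY y`. [cite: MoeglinVignerasWaldspurger1987, Chap. 2 I.4 Exemple (1)] -/
@[simp] theorem inY_v (y : Y) : (inY β y).v = (0, y) := rfl
/-- components of `inY y`. [cite: MoeglinVignerasWaldspurger1987, Chap. 2 I.4 Exemple (1)] -/
@[simp] theorem inY_t (y : Y) : (inY β y).t = 0 := rfl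

/-- **factorisation of a Heisenberg element along the polarisation**: `((x,y),t) = ((0,y),t) · ((x,0),0)` — in the
polarised law the cross term `β 0 0` vanishes. [cite: MoeglinVignerasWaldspurger1987, Chap. 2 I.4 Exemple (1)] -/
theorem eq_inY_mul_center_mul_inX (h : Heisenberg (polar β)) :
    h = (⟨(0, h.v.2), h.t⟩ : Heisenberg (polar β)) * inX β h.v.1 := by
  ext <;> simp [inX, polar_apply]

/-- `((u,0),0) · ((x,y),t) = ((u+x, y), t + β u y)`. [cite: MoeglinVignerasWaldspurger1987, Chap. 2 I.1] -/
theorem inX_mul (u : X) (h : Heisenberg (polar β)) :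
    inX β u * h = (⟨(u + h.v.1, h.v.2), h.t + β u h.v.2⟩ : Heisenberg (polar β)) := by
  ext <;> simp [inX, polar_apply]

/-- `((0,y), s) · ((x,0),0) = ((x,y), s)`. [cite: MoeglinVignerasWaldspurger1987, Chap. 2 I.1] -/
theorem inY_center_mul_inX (x : X) (y : Y) (s : R) :
    (⟨(0, y), s⟩ : Heisenberg (polar β)) * inX β x = ⟨(x, y), s⟩ := by
  ext <;> simp [inX, polar_apply]

variable {β}

/-- **the Frobenius map into functions on `X`**: `T_Λ f = (x ↦ Λ(ρ((x,0),0) f))`, for any linear functional `Λ` on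
the space of `ρ`. [cite: MoeglinVignerasWaldspurger1987, Chap. 2 I.3] -/
def frobeniusToSchrodinger (Λ : S →ₗ[ℂ] ℂ) : S →ₗ[ℂ] (X → ℂ) where
  toFun f x := Λ (ρ (inX β x) f)
  map_add' f g := by funext x; simp only [map_add, Pi.add_apply]
  map_smul' c f := by funext x; simp only [map_smul, smul_eq_mul, RingHom.id_apply, Pi.smul_apply]

/-- pointwise formula. [cite: MoeglinVignerasWaldspurger1987, Chap. 2 I.3] -/
@[simp] theorem frobeniusToSchrodinger_apply (Λ : S →ₗ[ℂ] ℂ) (f : S) (x : X) :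
    frobeniusToSchrodinger ρ Λ f x = Λ (ρ (inX β x) f) := rfl

/-- a `Y`-invariant functional on a representation with central character `ψ` is `(Y·Z, ψ)`-quasi-invariant:
`Λ(ρ((0,y),s) f) = ψ(s) Λ(f)`. [cite: MoeglinVignerasWaldspurger1987, Chap. 2 I.3] -/
theorem apply_rep_inY_center (Λ : S →ₗ[ℂ] ℂ)
    (hψ : ∀ (t : R) (f : S), ρ (⟨(0, 0), t⟩ : Heisenberg (polar β)) f = ((ψ t : Circle) : ℂ) • f)
    (hΛ : ∀ (y : Y) (f : S), Λ (ρ (inY β y) f) = Λ f) (y : Y) (s : R) (f : S) :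
    Λ (ρ (⟨(0, y), s⟩ : Heisenberg (polar β)) f) = ((ψ s : Circle) : ℂ) * Λ f := by
  have hfac : (⟨(0, y), s⟩ : Heisenberg (polar β)) = inY β y * ⟨(0, 0), s⟩ := by
    ext <;> simp [inY, polar_apply]
  rw [hfac, map_mul, Module.End.mul_apply, hΛ, hψ, map_smul, smul_eq_mul]

/-- **Frobenius reciprocity: `T_Λ` intertwines `ρ` with the Schrödinger model** — `T_Λ (ρ h f) = ρ_X(h) (T_Λ f)` for
every `h`, as soon as `ρ` has central character `ψ` and `Λ` is `Y`-invariant.  (Computation: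
`T_Λ(ρ h f)(u) = Λ(ρ(((u,0),0)·h) f)`, `((u,0),0)·((x,y),t) = ((0,y), t + β u y)·((u+x,0),0)`, and the left factor
acts on `Λ` by `ψ(t + β u y)`.) [cite: MoeglinVignerasWaldspurger1987, Chap. 2 I.3] -/
theorem frobeniusToSchrodinger_apply_rep (Λ : S →ₗ[ℂ] ℂ)
    (hψ : ∀ (t : R) (f : S), ρ (⟨(0, 0), t⟩ : Heisenberg (polar β)) f = ((ψ t : Circle) : ℂ) • f)
    (hΛ : ∀ (y : Y) (f : S), Λ (ρ (inY β y) f) = Λ f) (h : Heisenberg (polar β)) (f : S) :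
    frobeniusToSchrodinger ρ Λ (ρ h f) = schrodinger β ψ h (frobeniusToSchrodinger ρ Λ f) := by
  funext u
  rw [frobeniusToSchrodinger_apply, schrodinger_apply, frobeniusToSchrodinger_apply, ← Module.End.mul_apply, ← map_mul,
    inX_mul, ← inY_center_mul_inX β (u + h.v.1) h.v.2 (h.t + β u h.v.2), map_mul, Module.End.mul_apply,
    apply_rep_inY_center ψ ρ Λ hψ hΛ]

/-- **`T_Λ` is injective on any `ρ`-stable subspace on which `Λ ∘ ρ` separates points**; in particular if
`T_Λ f = 0` then `Λ(ρ h f) = 0` for EVERY `h` (not only `h ∈ X`): `Λ(ρ(((x,y),t)) f) = ψ(t) Λ(ρ((x,0),0) f)`… precisely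
`Λ (ρ h f) = ψ(h.t) · T_Λ f (h.v.1)` up to the `Y`-factor — recorded as the identity below.
[cite: MoeglinVignerasWaldspurger1987, Chap. 2 I.3] -/
theorem apply_rep_eq_mul_frobeniusToSchrodinger (Λ : S →ₗ[ℂ] ℂ)
    (hψ : ∀ (t : R) (f : S), ρ (⟨(0, 0), t⟩ : Heisenberg (polar β)) f = ((ψ t : Circle) : ℂ) • f)
    (hΛ : ∀ (y : Y) (f : S), Λ (ρ (inY β y) f) = Λ f) (h : Heisenberg (polar β)) (f : S) :
    Λ (ρ h f) = ((ψ h.t : Circle) : ℂ) * frobeniusToSchrodinger ρ Λ f h.v.1 := by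
  conv_lhs => rw [eq_inY_mul_center_mul_inX β h]
  rw [map_mul, Module.End.mul_apply, apply_rep_inY_center ψ ρ Λ hψ hΛ, frobeniusToSchrodinger_apply]

/-- hence **`ker T_Λ` is the largest `ρ`-stable subspace of `ker Λ`**: `T_Λ f = 0 ↔ ∀ h, Λ (ρ h f) = 0`.
[cite: MoeglinVignerasWaldspurger1987, Chap. 2 I.3] -/
theorem frobeniusToSchrodinger_eq_zero_iff (Λ : S →ₗ[ℂ] ℂ)
    (hψ : ∀ (t : R) (f : S), ρ (⟨(0, 0), t⟩ : Heisenberg (polar β)) f = ((ψ t : Circle) : ℂ) • f)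
    (hΛ : ∀ (y : Y) (f : S), Λ (ρ (inY β y) f) = Λ f) (f : S) :
    frobeniusToSchrodinger ρ Λ f = 0 ↔ ∀ h : Heisenberg (polar β), Λ (ρ h f) = 0 := by
  constructor
  · intro h0 h
    rw [apply_rep_eq_mul_frobeniusToSchrodinger ψ ρ Λ hψ hΛ, h0, Pi.zero_apply, mul_zero]
  · intro h
    funext x
    rw [frobeniusToSchrodinger_apply, Pi.zero_apply]
    exact h _

/-- **the range of `T_Λ` is a `ρ_X`-stable subspace** of `X → ℂ` (image of an intertwiner). [cite: MoeglinVignerasWaldspurger1987, Chap. 2 I.3] -/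
theorem schrodinger_mem_range_frobeniusToSchrodinger (Λ : S →ₗ[ℂ] ℂ)
    (hψ : ∀ (t : R) (f : S), ρ (⟨(0, 0), t⟩ : Heisenberg (polar β)) f = ((ψ t : Circle) : ℂ) • f)
    (hΛ : ∀ (y : Y) (f : S), Λ (ρ (inY β y) f) = Λ f) (h : Heisenberg (polar β)) {g : X → ℂ}
    (hg : g ∈ LinearMap.range (frobeniusToSchrodinger ρ Λ)) :
    schrodinger β ψ h g ∈ LinearMap.range (frobeniusToSchrodinger ρ Λ) := by
  obtain ⟨f, rfl⟩ := hg
  exact ⟨ρ h f, frobeniusToSchrodinger_apply_rep ψ ρ Λ hψ hΛ h f⟩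

end Literature.RepresentationTheory.HeisenbergGroup

end
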